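import Mathlib
import Literature.Combinatorics.Additive.TripleProductProperty
import Literature.Computability.AlgebraicComplexity.GroupTheoreticMatMul
import Literature.Computability.AlgebraicComplexity.GroupTheoreticMatMulThmBProofs
import Literature.Computability.AlgebraicComplexity.STPPTranslation

/-!
# Injective homomorphisms (in particular automorphisms) preserve STPP families

If `(Aᵢ, Bᵢ, Cᵢ)ᵢ` is an STPP family in an abelian group `H` and `φ : H →+ H'` is an injective additive
homomorphism, then `(φ(Aᵢ), φ(Bᵢ), φ(Cᵢ))ᵢ` is an STPP family in `H'`: the defining word
`(s′ − s) + (t′ − t) + (u′ − u)` is mapped to the corresponding word of the images, and injectivity pulls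
the conclusion back.  Special cases used by the census / existence engines of cell mm-stpp: automorphisms
`φ ∈ Aut(H)` (so search pools and SAT cubes may be quotiented by `Aut(H) ⋉ H` together with
`IsSTPP.translate` and `IsSTPP.shiftBC`), and subgroup embeddings `H ≤ H'` (an STPP family of a subgroup is
an STPP family of the ambient group).

* `AddSimultaneousTPP.map_of_injective` — CKSU convention;
* `IsSTPP.map_of_injective`, `IsSTPP.map_addEquiv` — census convention.

## References
* [CohnKleinbergSzegedyUmans2005] H. Cohn, R. Kleinberg, B. Szegedy, C. Umans, FOCS 2005, Def. 5.1.
* [BlasiakChurchCohnGrochowNaslundSawinUmans2017] Discrete Analysis 2017:3, Def. 2.2.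
-/

namespace Literature.Computability.AlgebraicComplexity

open Finset Literature.Combinatorics.Additive

variable {H H' : Type*} [AddCommGroup H] [AddCommGroup H'] [DecidableEq H']

/-- **Injective homomorphisms preserve the STPP** (CKSU convention). [cite: CohnKleinbergSzegedyUmans2005, Def. 5.1] -/
theorem _root_.Literature.Combinatorics.Additive.AddSimultaneousTPP.map_of_injective {ι : Type*}
    {A B C : ι → Finset H} (h : AddSimultaneousTPP A B C) (φ : H →+ H')
    (hφ : Function.Injective φ) :
    AddSimultaneousTPP (fun i => (A i).image φ) (fun i => (B i).image φ)
      (fun i => (C i).image φ) := by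
  rw [addSimultaneousTPP_iff_forall] at h ⊢
  intro i j k s hs s' hs' v hv v' hv' u hu u' hu' he
  obtain ⟨a, ha, rfl⟩ := Finset.mem_image.1 hs
  obtain ⟨a', ha', rfl⟩ := Finset.mem_image.1 hs'
  obtain ⟨b, hb, rfl⟩ := Finset.mem_image.1 hv
  obtain ⟨b', hb', rfl⟩ := Finset.mem_image.1 hv'
  obtain ⟨c, hc, rfl⟩ := Finset.mem_image.1 hu
  obtain ⟨c', hc', rfl⟩ := Finset.mem_image.1 hu'
  have key : (a' - a) + (b' - b) + (c' - c) = 0 := by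
    apply hφ
    rw [map_zero, ← he]
    simp only [map_add, map_sub]
  obtain ⟨hij, hjk, e1, e2, e3⟩ := h i j k a ha a' ha' b hb b' hb' c hc c' hc' key
  subst hij; subst hjk
  exact ⟨rfl, rfl, by rw [e1], by rw [e2], by rw [e3]⟩

/-- **Injective homomorphisms preserve the STPP**, census convention `IsSTPP`.
[cite: BlasiakChurchCohnGrochowNaslundSawinUmans2017, Def. 2.2] -/
theorem IsSTPP.map_of_injective {N : ℕ} {A B C : Fin N → Finset H} (h : IsSTPP A B C)
    (φ : H →+ H') (hφ : Function.Injective φ) :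
    IsSTPP (fun i => (A i).image φ) (fun i => (B i).image φ) (fun i => (C i).image φ) := by
  rw [isSTPP_iff_addSimultaneousTPP] at h ⊢
  exact h.map_of_injective φ hφ

/-- **Automorphisms preserve the STPP** (census convention): for `φ : H ≃+ H'`.
[cite: BlasiakChurchCohnGrochowNaslundSawinUmans2017, Def. 2.2] -/
theorem IsSTPP.map_addEquiv {N : ℕ} {A B C : Fin N → Finset H} (h : IsSTPP A B C) (φ : H ≃+ H') :
    IsSTPP (fun i => (A i).image φ) (fun i => (B i).image φ) (fun i => (C i).image φ) := by
  simpa using h.map_of_injective φ.toAddMonoidHom φ.injective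

end Literature.Computability.AlgebraicComplexity
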